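import Literature.Geometry.Kaehler.HolomorphicChainLelongNumber
import HarnessLib

/-!
# The Lelong number of a holomorphic chain as a function of the point

Layer `Literature/Geometry/Kaehler`; lane `lit-hodgefound`, seat p07, programme «MINIMALITY & MASS»,
file F6. For a holomorphic `p`-chain `T = Σ k_Z Z` on the open set `Ω ⊆ V` (`p = q + 1`) the
Lelong number (multiplicity function) of `T` at `a ∈ Ω` is `n([T], a) = Σ_Z |k_Z| n(Z, a)`, the
`2p`-density of the mass measure `‖[T]‖` (`HolomorphicChain.hasDensity_massMeasure`,
`HolomorphicChainLelongNumber.lean`), written `∑ᶠ Z, |k_Z| · lelongNumber Z p a`. This file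
collects its elementary properties as a function of `a`, from those of `n(Z, ·)`
(`LelongNumber.lean`, [Chirka1989, §11.1, §15.1]) and the local finiteness of the family of
components:

* `HolomorphicChain.finsum_lelongNumber_eq_sum` — near every point the `finsum` is a finite sum
  over the components meeting a closed ball;
* `HolomorphicChain.finsum_lelongNumber_ne_top`, `HolomorphicChain.finsum_lelongNumber_eq_zero`
  (`a ∈ Ω ∖ |T|`), `HolomorphicChain.one_le_finsum_lelongNumber_of_mem_support` (`a ∈ |T|`,
  [Chirka1989, §15.1 Prop. 2]), `HolomorphicChain.finsum_lelongNumber_pos_iff`;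
* `HolomorphicChain.upperSemicontinuousAt_finsum_lelongNumber`,
  `HolomorphicChain.upperSemicontinuousOn_finsum_lelongNumber` — **`a ↦ n([T], a)` is upper
  semicontinuous on `Ω`** [Chirka1989, §11.1: "`μ_z(A)` … becomes upper semicontinuous in any
  domain in which `A` is closed"];
* `HolomorphicChain.eventually_finsum_lelongNumber_le` — the discrete form `n([T], x) ≤ n([T], a)`
  near `a` (the values are integers, `HolomorphicChain.exists_nat_eq_finsum_lelongNumber`);
* `HolomorphicChain.isClosed_preimage_finsum_lelongNumber_Ici` — **the upper level sets
  `E_c(T) = {a ∈ Ω : n([T], a) ≥ c}` are closed in `Ω`** [Demailly1993, Prop. 3.11].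

Theorems only; no new definitions, no named facts.

## References

* [Chirka1989] E. M. Chirka, *Complex Analytic Sets*, Kluwer 1989, §11.1 (p. 120), §15.1 Prop. 2
  (p. 190), §16.1 (p. 206) (held `book:chirkand-complex-analytic-sets`).
* [Demailly1993] J.-P. Demailly, *Monge–Ampère operators, Lelong numbers and intersection
  theory*, 1993, Prop. 3.11.
-/

noncomputable section

open scoped Manifold Topology ENNReal
open Set Filter MeasureTheory Metric

namespace Literature.Geometry.Kaehler

open Literature.Geometry.GeometricMeasureTheory

universe u

variable {V : Type u} [NormedAddCommGroup V] [InnerProductSpace ℂ V] [FiniteDimensional ℂ V]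
  [MeasurableSpace V] [BorelSpace V] {Ω : TopologicalSpace.Opens V} {q : ℕ}

namespace HolomorphicChain

/-! ### Local finiteness: the `finsum` is a finite sum near every point -/

omit [FiniteDimensional ℂ V] in
/-- **Near every point `n([T], ·)` is a finite sum.** If `𝐁(a, r₀) ⊆ Ω` and the finite set `F`
contains every component of nonzero multiplicity meeting `𝐁(a, r₀)`, then for `x ∈ 𝐁(a, r₀)`,
`Σ_Z |k_Z| n(Z, x) = Σ_{Z ∈ F} |k_Z| n(Z, x)` (a component not through `x` has `n(Z, x) = 0`).
[cite: Chirka1989, §11.5 Def., p. 130; §11.1, p. 120] -/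
theorem finsum_lelongNumber_eq_sum (T : HolomorphicChain 𝓘(ℂ, V) Ω (q + 1)) {a : V} {r₀ : ℝ}
    (hK : closedBall a r₀ ⊆ (Ω : Set V)) (F : Finset (Set Ω))
    (hF : ∀ Z : Set Ω, T.mult Z ≠ 0 → (((↑) '' Z : Set V) ∩ closedBall a r₀).Nonempty → Z ∈ F)
    {x : V} (hx : x ∈ closedBall a r₀) :
    (∑ᶠ Z : Set Ω, ENNReal.ofReal |(T.mult Z : ℝ)| * lelongNumber Z (q + 1) x) =
      ∑ Z ∈ F, ENNReal.ofReal |(T.mult Z : ℝ)| * lelongNumber Z (q + 1) x := by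
  refine finsum_eq_sum_of_support_subset _ fun Z hZ => ?_
  rw [Function.mem_support] at hZ
  have hm : T.mult Z ≠ 0 := fun h => hZ (by simp [h])
  have hn : lelongNumber Z (q + 1) x ≠ 0 := fun h => hZ (by simp [h])
  have hxZ : x ∈ ((↑) '' Z : Set V) := by
    by_contra h
    exact hn (lelongNumber_eq_zero (T.hasPureDim_of_mult_ne_zero hm) (hK hx) h)
  exact Finset.mem_coe.2 (hF Z hm ⟨x, hxZ, hx⟩)

omit [MeasurableSpace V] [BorelSpace V] in
/-- The finite set of components of nonzero multiplicity meeting a closed ball `𝐁(a, r₀) ⊆ Ω`.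
[cite: Chirka1989, §11.5 Def., p. 130] -/
theorem exists_finset_components_inter_closedBall (T : HolomorphicChain 𝓘(ℂ, V) Ω (q + 1))
    {a : V} {r₀ : ℝ} (hK : closedBall a r₀ ⊆ (Ω : Set V)) :
    ∃ F : Finset (Set Ω), (∀ Z ∈ F, T.mult Z ≠ 0) ∧
      ∀ Z : Set Ω, T.mult Z ≠ 0 → (((↑) '' Z : Set V) ∩ closedBall a r₀).Nonempty → Z ∈ F := by
  classical
  have hKc := isCompact_preimage_coe_closedBall (Ω := Ω) hK
  refine ⟨(T.finite_inter_compact hKc).toFinset, fun Z hZ => ((Set.Finite.mem_toFinset _).1 hZ).1,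
    ?_⟩
  rintro Z hZ ⟨_, ⟨x', hx', rfl⟩, hxK⟩
  exact (Set.Finite.mem_toFinset _).2 ⟨hZ, ⟨x', hxK, hx'⟩⟩

/-! ### Values: finite, `0` off the support, `≥ 1` on it -/

/-- `n([T], a) < ∞` for `a ∈ Ω`. [cite: Chirka1989, §15.1 Prop. 1, p. 189] -/
theorem finsum_lelongNumber_ne_top (T : HolomorphicChain 𝓘(ℂ, V) Ω (q + 1)) {a : V}
    (ha : a ∈ (Ω : Set V)) :
    (∑ᶠ Z : Set Ω, ENNReal.ofReal |(T.mult Z : ℝ)| * lelongNumber Z (q + 1) a) ≠ ⊤ := by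
  obtain ⟨n, hn⟩ := T.exists_nat_eq_finsum_lelongNumber ha
  rw [hn]
  exact ENNReal.natCast_ne_top n

omit [FiniteDimensional ℂ V] in
/-- `n([T], a) = 0` for `a ∈ Ω ∖ |T|` (every term vanishes: `n(Z, a) = 0` off `Z`).
[cite: Chirka1989, §11.1, p. 120] -/
theorem finsum_lelongNumber_eq_zero (T : HolomorphicChain 𝓘(ℂ, V) Ω (q + 1)) {a : V}
    (ha : a ∈ (Ω : Set V)) (haT : a ∉ ((↑) '' T.support : Set V)) :
    (∑ᶠ Z : Set Ω, ENNReal.ofReal |(T.mult Z : ℝ)| * lelongNumber Z (q + 1) a) = 0 := by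
  refine finsum_eq_zero_of_forall_eq_zero fun Z => ?_
  by_cases hm : T.mult Z = 0
  · simp [hm]
  · have haZ : a ∉ ((↑) '' Z : Set V) := fun h => haT (image_mono (T.subset_support hm) h)
    rw [lelongNumber_eq_zero (T.hasPureDim_of_mult_ne_zero hm) ha haZ, mul_zero]

/-- **`1 ≤ n([T], a)` at every point `a ∈ |T|`**: some component `Z ∋ a` has `k_Z ≠ 0`, so
`|k_Z| ≥ 1` and `n(Z, a) ≥ 1` [Chirka1989, §15.1 Prop. 2]; the other terms are `≥ 0`.
[cite: Chirka1989, §15.1 Prop. 2, p. 190; §16.1, p. 206] -/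
theorem one_le_finsum_lelongNumber_of_mem_support (T : HolomorphicChain 𝓘(ℂ, V) Ω (q + 1))
    {w : Ω} (hw : w ∈ T.support) :
    1 ≤ ∑ᶠ Z : Set Ω, ENNReal.ofReal |(T.mult Z : ℝ)| * lelongNumber Z (q + 1) (w : V) := by
  classical
  obtain ⟨Z, hZ, hwZ⟩ := mem_support_iff.1 hw
  obtain ⟨R₀, hR₀, hR₀Ω⟩ := Metric.isOpen_iff.1 Ω.isOpen (w : V) w.2
  have hK : closedBall (w : V) (R₀ / 2) ⊆ (Ω : Set V) :=
    (closedBall_subset_ball (by linarith)).trans hR₀Ω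
  obtain ⟨F, -, hF⟩ := T.exists_finset_components_inter_closedBall hK
  have hw0 : (w : V) ∈ closedBall (w : V) (R₀ / 2) := mem_closedBall_self (by positivity)
  rw [T.finsum_lelongNumber_eq_sum hK F hF hw0]
  have hZF : Z ∈ F := hF Z hZ ⟨w, ⟨w, hwZ, rfl⟩, hw0⟩
  refine le_trans ?_ (Finset.single_le_sum (fun Z' _ => zero_le) hZF)
  have h1 : (1 : ℝ≥0∞) ≤ ENNReal.ofReal |(T.mult Z : ℝ)| := by
    rw [← ENNReal.ofReal_one]
    refine ENNReal.ofReal_le_ofReal ?_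
    have : (1 : ℤ) ≤ |T.mult Z| := Int.one_le_abs hZ
    exact_mod_cast this
  calc (1 : ℝ≥0∞) = 1 * 1 := (one_mul _).symm
    _ ≤ ENNReal.ofReal |(T.mult Z : ℝ)| * lelongNumber Z (q + 1) (w : V) :=
        mul_le_mul' h1 (one_le_lelongNumber (T.hasPureDim_of_mult_ne_zero hZ) hwZ)

/-- **`n([T], a) > 0` iff `a ∈ |T|`**, for `a ∈ Ω`. [cite: Chirka1989, §15.1 Prop. 2, p. 190;
§11.1, p. 120] -/
theorem finsum_lelongNumber_pos_iff (T : HolomorphicChain 𝓘(ℂ, V) Ω (q + 1)) {a : V}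
    (ha : a ∈ (Ω : Set V)) :
    0 < (∑ᶠ Z : Set Ω, ENNReal.ofReal |(T.mult Z : ℝ)| * lelongNumber Z (q + 1) a) ↔
      a ∈ ((↑) '' T.support : Set V) := by
  constructor
  · intro h
    by_contra haT
    exact h.ne' (T.finsum_lelongNumber_eq_zero ha haT)
  · rintro ⟨w, hw, rfl⟩
    exact lt_of_lt_of_le zero_lt_one (T.one_le_finsum_lelongNumber_of_mem_support hw)

/-! ### Upper semicontinuity in the point -/

/-- **`a ↦ n([T], a) = Σ_Z |k_Z| n(Z, a)` is upper semicontinuous at every `a ∈ Ω`**: near `a` it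
is a finite sum of the upper semicontinuous functions `|k_Z| n(Z, ·)`
(`lelongNumber_upperSemicontinuousAt`). [cite: Chirka1989, §11.1, p. 120] -/
theorem upperSemicontinuousAt_finsum_lelongNumber (T : HolomorphicChain 𝓘(ℂ, V) Ω (q + 1))
    {a : V} (ha : a ∈ (Ω : Set V)) :
    UpperSemicontinuousAt
      (fun x => ∑ᶠ Z : Set Ω, ENNReal.ofReal |(T.mult Z : ℝ)| * lelongNumber Z (q + 1) x) a := by
  obtain ⟨R₀, hR₀, hR₀Ω⟩ := Metric.isOpen_iff.1 Ω.isOpen a ha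
  have hK : closedBall a (R₀ / 2) ⊆ (Ω : Set V) :=
    (closedBall_subset_ball (by linarith)).trans hR₀Ω
  obtain ⟨F, hFne, hF⟩ := T.exists_finset_components_inter_closedBall hK
  -- the finite sum is upper semicontinuous
  have husc : UpperSemicontinuousAt
      (fun x => ∑ Z ∈ F, ENNReal.ofReal |(T.mult Z : ℝ)| * lelongNumber Z (q + 1) x) a := by
    refine upperSemicontinuousAt_sum fun Z hZ => ?_
    have h1 := lelongNumber_upperSemicontinuousAt (T.hasPureDim_of_mult_ne_zero (hFne Z hZ)) ha
    have hc : Continuous fun y : ℝ≥0∞ => ENNReal.ofReal |(T.mult Z : ℝ)| * y :=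
      ENNReal.continuous_const_mul ENNReal.ofReal_ne_top
    exact hc.continuousAt.comp_upperSemicontinuousAt h1 fun y y' h => mul_le_mul_right h _
  -- and agrees with the `finsum` near `a`
  have heq : ∀ᶠ x in 𝓝[univ] a,
      (∑ Z ∈ F, ENNReal.ofReal |(T.mult Z : ℝ)| * lelongNumber Z (q + 1) x) =
        ∑ᶠ Z : Set Ω, ENNReal.ofReal |(T.mult Z : ℝ)| * lelongNumber Z (q + 1) x := by
    rw [nhdsWithin_univ]
    filter_upwards [Metric.ball_mem_nhds a (half_pos hR₀)] with x hx
    exact (T.finsum_lelongNumber_eq_sum hK F hF (ball_subset_closedBall hx)).symm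
  exact upperSemicontinuousWithinAt_univ_iff.1
    ((husc.upperSemicontinuousWithinAt univ).congr_of_eventuallyEq (mem_univ a) heq)

/-- **Upper semicontinuity on `Ω`.** [cite: Chirka1989, §11.1, p. 120] -/
theorem upperSemicontinuousOn_finsum_lelongNumber (T : HolomorphicChain 𝓘(ℂ, V) Ω (q + 1)) :
    UpperSemicontinuousOn
      (fun x => ∑ᶠ Z : Set Ω, ENNReal.ofReal |(T.mult Z : ℝ)| * lelongNumber Z (q + 1) x)
      (Ω : Set V) := fun _ ha =>
  (T.upperSemicontinuousAt_finsum_lelongNumber ha).upperSemicontinuousWithinAt _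

/-- **Discrete form of upper semicontinuity**: `n([T], x) ≤ n([T], a)` for all `x` near `a ∈ Ω`
(the values are natural numbers and `n([T], x) < n([T], a) + 1` near `a`).
[cite: Chirka1989, §11.1, p. 120; §16.1 Prop. 1 (proof), p. 207] -/
theorem eventually_finsum_lelongNumber_le (T : HolomorphicChain 𝓘(ℂ, V) Ω (q + 1)) {a : V}
    (ha : a ∈ (Ω : Set V)) :
    ∀ᶠ x in 𝓝 a, (∑ᶠ Z : Set Ω, ENNReal.ofReal |(T.mult Z : ℝ)| * lelongNumber Z (q + 1) x) ≤
      ∑ᶠ Z : Set Ω, ENNReal.ofReal |(T.mult Z : ℝ)| * lelongNumber Z (q + 1) a := by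
  obtain ⟨k, hk⟩ := T.exists_nat_eq_finsum_lelongNumber ha
  have hlt : (∑ᶠ Z : Set Ω, ENNReal.ofReal |(T.mult Z : ℝ)| * lelongNumber Z (q + 1) a) <
      (∑ᶠ Z : Set Ω, ENNReal.ofReal |(T.mult Z : ℝ)| * lelongNumber Z (q + 1) a) + 1 :=
    ENNReal.lt_add_right (T.finsum_lelongNumber_ne_top ha) one_ne_zero
  have hev := T.upperSemicontinuousAt_finsum_lelongNumber ha _ hlt
  have hΩ : ∀ᶠ x in 𝓝 a, x ∈ (Ω : Set V) := Ω.isOpen.mem_nhds ha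
  filter_upwards [hev, hΩ] with x hx hxΩ
  obtain ⟨m, hm⟩ := T.exists_nat_eq_finsum_lelongNumber hxΩ
  rw [hm, hk] at hx ⊢
  have hmk : m < k + 1 := by exact_mod_cast hx
  exact_mod_cast Nat.lt_succ_iff.1 hmk

/-- **The upper level sets `E_c(T) = {a ∈ Ω : n([T], a) ≥ c}` are closed in `Ω`** (as subsets
of the subtype `Ω`). [cite: Demailly1993, Prop. 3.11] -/
theorem isClosed_preimage_finsum_lelongNumber_Ici (T : HolomorphicChain 𝓘(ℂ, V) Ω (q + 1))
    (c : ℝ≥0∞) :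
    IsClosed (((↑) : Ω → V) ⁻¹'
      ((fun x => ∑ᶠ Z : Set Ω, ENNReal.ofReal |(T.mult Z : ℝ)| * lelongNumber Z (q + 1) x) ⁻¹'
        Ici c)) := by
  have h : UpperSemicontinuous ((Ω : Set V).restrict
      fun x => ∑ᶠ Z : Set Ω, ENNReal.ofReal |(T.mult Z : ℝ)| * lelongNumber Z (q + 1) x) :=
    upperSemicontinuousOn_iff_restrict.2 T.upperSemicontinuousOn_finsum_lelongNumber
  exact h.isClosed_preimage c

/-- The support of `T` in `Ω` is the level set `E_1(T) = {n([T], ·) ≥ 1}`; in particular it is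
closed in `Ω` (another road to `isClosed_support`). [cite: Chirka1989, §15.1 Prop. 2, p. 190] -/
theorem support_eq_preimage_finsum_lelongNumber_Ici (T : HolomorphicChain 𝓘(ℂ, V) Ω (q + 1)) :
    T.support = ((↑) : Ω → V) ⁻¹'
      ((fun x => ∑ᶠ Z : Set Ω, ENNReal.ofReal |(T.mult Z : ℝ)| * lelongNumber Z (q + 1) x) ⁻¹'
        Ici 1) := by
  ext w
  simp only [mem_preimage, mem_Ici]
  constructor
  · exact T.one_le_finsum_lelongNumber_of_mem_support
  · intro h
    have hpos := (T.finsum_lelongNumber_pos_iff w.2).1 (lt_of_lt_of_le zero_lt_one h)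
    obtain ⟨w', hw', hww'⟩ := hpos
    rwa [← Subtype.ext hww']

end HolomorphicChain

end Literature.Geometry.Kaehler
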